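import Summits.MatrixMultiplication.OmegaCensus.SmallFormats.MatMul22nBrentAtPoint
import HarnessLib

/-!
# ω-census family (a): the INV-layer pairing `Q s t = vec(W_s) · T(Y) vec(G_t) = ∑_{p,q} Y q p (W_s row p · G_t row q)` (any field)

Cell `pub-omega` (unit `pub-omega-tensor`, gen 40), topic `Summits/MatrixMultiplication/OmegaCensus` (sub-folder
`SmallFormats`). Framing (verbatim): lottery ticket; floor = certified bounds/negative ranges. HONEST FRAMING: M1-LEAN-BLUEPRINT F6 (first lemma): the entries of
the matrix `Q` of `SylvesterRank.card_add_le_rank_sub_sum` for `T = T(X₀)` (`BrentAtPoint`, `T(X₀)⁻¹ = T(X₀⁻¹)`) are block pairings of the ROWS of `W_s` with the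
ROWS of `G_t` weighted by `N p q = Y q p` (`Y = X₀⁻¹`): `PointPairing.vec_dot_pointMatrix_mulVec`. Pure bookkeeping. Nothing here is a bound on `ω`.
-/

namespace Summit.MatrixMultiplication.OmegaCensus.SmallFormats

open Finset Matrix

namespace PointPairing

variable {k : Type*} [Field k] {n : ℕ}

/-- `T(Y) *ᵥ g` in coordinates: `(T(Y) g)(p, i) = ∑_q Y q p · g (q, i)`. -/
theorem pointMatrix_mulVec_apply (Y : Matrix (Fin 2) (Fin 2) k) (g : Fin 2 × Fin n → k) (a : Fin 2 × Fin n) :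
    Matrix.mulVec (Matrix.of fun (a : Fin 2 × Fin n) (b : Fin 2 × Fin n) => Y b.1 a.1 * (if a.2 = b.2 then (1 : k) else 0)) g a =
      ∑ q, Y q a.1 * g (q, a.2) := by
  rw [Matrix.mulVec, dotProduct, Fintype.sum_prod_type]
  refine Finset.sum_congr rfl fun q _ => ?_
  simp only [Matrix.of_apply]
  rw [Finset.sum_eq_single a.2]
  · simp
  · intro j _ hj; simp [Ne.symm hj]
  · intro h; exact absurd (Finset.mem_univ _) h

/-- **The pairing formula.** `w ⬝ᵥ (T(Y) *ᵥ g) = ∑_{p,q} Y q p · ∑_i w (p,i) g (q,i)` — with `w = vec(W_s)`, `g = vec(G_t)`, `Y = X₀⁻¹` this is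
`Q s t = ∑_{p,q} N p q (W_s row p ⬝ᵥ G_t row q)`, `N p q = X₀⁻¹ q p`. -/
theorem vec_dot_pointMatrix_mulVec (Y : Matrix (Fin 2) (Fin 2) k) (w g : Fin 2 × Fin n → k) :
    w ⬝ᵥ Matrix.mulVec (Matrix.of fun (a : Fin 2 × Fin n) (b : Fin 2 × Fin n) => Y b.1 a.1 * (if a.2 = b.2 then (1 : k) else 0)) g =
      ∑ p, ∑ q, Y q p * ∑ i, w (p, i) * g (q, i) := by
  rw [dotProduct, Fintype.sum_prod_type]
  refine Finset.sum_congr rfl fun p _ => ?_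
  simp_rw [pointMatrix_mulVec_apply, Finset.mul_sum]
  rw [Finset.sum_comm]
  refine Finset.sum_congr rfl fun q _ => Finset.sum_congr rfl fun i _ => by ring

/-- Matrix form: for `W G : Matrix (Fin 2) (Fin n) k`, `vec(W) ⬝ᵥ T(Y) vec(G) = ∑_{p,q} Y q p · (W p ⬝ᵥ G q)`. -/
theorem vecW_dot_pointMatrix_vecG (Y : Matrix (Fin 2) (Fin 2) k) (W G : Matrix (Fin 2) (Fin n) k) :
    (fun a : Fin 2 × Fin n => W a.1 a.2) ⬝ᵥ
        Matrix.mulVec (Matrix.of fun (a : Fin 2 × Fin n) (b : Fin 2 × Fin n) => Y b.1 a.1 * (if a.2 = b.2 then (1 : k) else 0))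
          (fun a : Fin 2 × Fin n => G a.1 a.2) =
      ∑ p, ∑ q, Y q p * (W p ⬝ᵥ G q) := by
  rw [vec_dot_pointMatrix_mulVec]
  rfl

end PointPairing

end Summit.MatrixMultiplication.OmegaCensus.SmallFormats
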